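import Summits.RiemannHypothesis.RiemannHypothesis.Theses.GroundBarta
import Summits.RiemannHypothesis.RiemannHypothesis.Theorems.OddSectorOddNegativityOffLine
import Summits.RiemannHypothesis.RiemannHypothesis.Theorems.WeilParityEvenSectorWinsUpToLogThreeHalf
import Literature.NumberTheory.LFunctions.WeilExplicit

/-!
# Crux attack on `GroundBarta.PolarPerronFrobenius` (stmt-RiemannHypothesis-18390) — the logical shape

Refuter evidence (crux-attack at birth, refuter-rattack-stmt-RiemannHypothesis-18390-0, 2026-08-17).
Kernel-checked bookkeeping, no analysis. Write `EW a` for the window-`a` clause of `EvenWinsBeyondArch`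
(the even sector carries the bottom) and `GSP a` for "some ground state of the full windowed Weil form at
`a` (junk-free ∀h-eventually encoding) is real and `≥ 0` a.e. on `(-a, a)`" (= the hypothesis clause of the
rung `GroundBartaFloor` at `a`). Then, literally (`Iff.rfl`),

  `PolarPerronFrobenius ↔ ∀ A, ∃ a ≥ A, (EW a → GSP a)`.

* `polarPF_iff_eventually_imp_cofinal` — pure logic: the crux is EQUIVALENT to
  `(∀ᶠ a in atTop, EW a) → (∀ A, ∃ a ≥ A, GSP a)` ("IF the even sector eventually always wins, THEN
  one-signed ground states exist beyond every height").
* `polarPF_of_frequently_not_EW` — hence the crux holds VACUOUSLY as soon as crux #4 fails cofinally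
  (`∃ᶠ a in atTop, ¬ EW a`), and `eventually_EW_of_not_polarPF` — a REFUTATION of the crux would PROVE the
  tail of crux #4 (`∀ᶠ a, EW a`, NoParityCrossing-strength): cruxes #3 and #4 cannot both be refuted, and
  #3 is irrefutable short of proving eventual even dominance.
* `not_imp_of_nonpos` — at every degenerate window `a ≤ 0` the matrix `EW a → GSP a` is FALSE (`EW a` holds
  vacuously, `GSP a` fails: no normalised test lives on a null window); harmless, absorbed by `∃ a ≥ A`.
* `eventually_not_GSP_of_floor` / `polarPF_iff_frequently_not_EW_of_floor` — with the rung `GroundBartaFloor`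
  and the PROVED detector `OddNegativityOffLine`, off the critical line NO large window carries a one-signed
  ground state, so `¬RH → (PolarPerronFrobenius ↔ ∃ᶠ a, ¬ EW a)`: under `¬RH` the crux has no content beyond
  "#4 fails cofinally" (this is the route's `closes` read contrapositively).
* `rh_of_floor_of_cofinal_GSP` — the hypothesis `EW` is only a funnel: rung + cofinal `GSP` already give RH
  (no parity statement needed); `EW a` enters because the intended MECHANISM (Perron–Frobenius in the even
  block + Aronszajn–Krein) produces an EVEN one-signed state, which is a ground state of the FULL form only
  when the even sector carries the bottom.

NOT available (and not claimed): `RiemannHypothesis → PolarPerronFrobenius`. Unlike the rung (RH-implied with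
`e ≡ 0`), this crux is RH-bearing but not RH-implied: it can fail with RH true (kill criterion k2 of the route).
-/

noncomputable section
set_option linter.dupNamespace false

namespace Summit.RiemannHypothesis.RiemannHypothesis.Cruxes.PolarPerronFrobenius.Attack

open Filter Set MeasureTheory
open Literature.NumberTheory.LFunctions
open Summit.RiemannHypothesis.RiemannHypothesis.Theses.GroundBarta

/-- `EW a`: the even sector carries the bottom at window `a` (window-`a` clause of `EvenWinsBeyondArch`). -/
def EW (a : ℝ) : Prop :=
  ∀ o : ℝ → ℂ, IsWeilTest o → tsupport o ⊆ Icc (-a) a → (∀ t, o (-t) = -o t) →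
    ∫ t, ‖o t‖ ^ 2 = (1 : ℝ) → ∀ δ : ℝ, 0 < δ → ∃ w : ℝ → ℂ, IsWeilTest w ∧
      tsupport w ⊆ Icc (-a) a ∧ (∀ t, w (-t) = w t) ∧ ∫ t, ‖w t‖ ^ 2 = (1 : ℝ) ∧
      (weilQuadratic w).re ≤ (weilQuadratic o).re + δ

/-- `IsGroundStateJF a u`: junk-free (∀h-eventually) encoding of "`u` is a ground state of the windowed
Weil form at `a`" (parity-free twin of `IsWeilOddGroundState`; the route items inline it). -/
def IsGroundStateJF (a : ℝ) (u : ℝ → ℂ) : Prop :=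
  MemLp u 2 ∧ ∃ g : ℕ → ℝ → ℂ,
    (∀ n, IsWeilTest (g n) ∧ tsupport (g n) ⊆ Icc (-a) a ∧ ∫ t, ‖g n t‖ ^ 2 = (1 : ℝ)) ∧
    (∀ h : ℝ → ℂ, IsWeilTest h → tsupport h ⊆ Icc (-a) a → ∫ t, ‖h t‖ ^ 2 = (1 : ℝ) →
      ∀ δ : ℝ, 0 < δ → ∀ᶠ n in atTop, (weilQuadratic (g n)).re ≤ (weilQuadratic h).re + δ) ∧
    Tendsto (fun n => ∫ t, ‖g n t - u t‖ ^ 2) atTop (nhds 0)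

/-- `GSP a`: some ground state at `a` is real and `≥ 0` a.e. on `(-a, a)` (= the hypothesis clause of the
rung `GroundBartaFloor` at `a`, = the conclusion of `PolarPerronFrobenius` at `a`). -/
def GSP (a : ℝ) : Prop :=
  ∃ u : ℝ → ℂ, IsGroundStateJF a u ∧ (∀ᵐ t : ℝ, t ∈ Ioo (-a) a → (u t).im = 0 ∧ 0 ≤ (u t).re)

/-- READBACK: the crux is literally `∀ A, ∃ a ≥ A, (EW a → GSP a)` over the Literature vocabulary. -/
theorem polarPF_iff : PolarPerronFrobenius ↔ ∀ A : ℝ, ∃ a : ℝ, A ≤ a ∧ (EW a → GSP a) :=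
  Iff.rfl

/-- READBACK of the rung's hypothesis: `GroundBartaFloor` quantifies over exactly the windows with `GSP a`. -/
theorem groundBartaFloor_iff :
    GroundBartaFloor ↔ ∃ e : ℝ → ℝ, Tendsto e atTop (nhds 0) ∧ ∃ a₀ : ℝ, ∀ a : ℝ, a₀ ≤ a → GSP a →
      ∀ h : ℝ → ℂ, IsWeilTest h → tsupport h ⊆ Icc (-a) a → ∫ t, ‖h t‖ ^ 2 = (1 : ℝ) →
        -e a ≤ (weilQuadratic h).re :=
  Iff.rfl

/-- READBACK of crux #4: `EvenWinsBeyondArch ↔ ∀ a > (log 2)/2, EW a`. -/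
theorem evenWinsBeyondArch_iff : EvenWinsBeyondArch ↔ ∀ a : ℝ, Real.log 2 / 2 < a → EW a :=
  Iff.rfl

/-! ## Pure logic of the quantifier shape `∀ A, ∃ a ≥ A, (P a → R a)` -/

/-- `∀ A, ∃ a ≥ A, (P a → R a)` ↔ `(∀ᶠ a in atTop, P a) → ∀ A, ∃ a ≥ A, R a`. -/
theorem forall_exists_ge_imp_iff {P R : ℝ → Prop} :
    (∀ A : ℝ, ∃ a : ℝ, A ≤ a ∧ (P a → R a)) ↔
      ((∀ᶠ a in atTop, P a) → ∀ A : ℝ, ∃ a : ℝ, A ≤ a ∧ R a) := by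
  constructor
  · intro h hP A
    obtain ⟨A₀, hA₀⟩ := eventually_atTop.1 hP
    obtain ⟨a, ha, himp⟩ := h (max A A₀)
    exact ⟨a, le_trans (le_max_left _ _) ha, himp (hA₀ a (le_trans (le_max_right _ _) ha))⟩
  · intro h A
    by_cases hP : ∀ᶠ a in atTop, P a
    · obtain ⟨a, ha, hR⟩ := h hP A
      exact ⟨a, ha, fun _ => hR⟩
    · have hfr : ∃ᶠ a in atTop, ¬ P a := not_eventually.1 hP
      obtain ⟨a, ha, hna⟩ := frequently_atTop.1 hfr A
      exact ⟨a, ha, fun hPa => absurd hPa hna⟩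

/-- **The crux, unfolded**: `PolarPerronFrobenius ↔ ((∀ᶠ a, EW a) → ∀ A, ∃ a ≥ A, GSP a)`. -/
theorem polarPF_iff_eventually_imp_cofinal :
    PolarPerronFrobenius ↔ ((∀ᶠ a in atTop, EW a) → ∀ A : ℝ, ∃ a : ℝ, A ≤ a ∧ GSP a) :=
  polarPF_iff.trans forall_exists_ge_imp_iff

/-- **Vacuity channel**: if crux #4 fails cofinally, crux #3 holds with nothing to show. -/
theorem polarPF_of_frequently_not_EW (h : ∃ᶠ a in atTop, ¬ EW a) : PolarPerronFrobenius :=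
  polarPF_iff_eventually_imp_cofinal.2 fun hev => absurd hev (not_eventually.2 h)

/-- The intended content: cofinal one-signed ground states give the crux (hypothesis `EW` unused). -/
theorem polarPF_of_cofinal_GSP (h : ∀ A : ℝ, ∃ a : ℝ, A ≤ a ∧ GSP a) : PolarPerronFrobenius :=
  polarPF_iff_eventually_imp_cofinal.2 fun _ => h

/-- Negation normal form of the crux. -/
theorem not_polarPF_iff : ¬ PolarPerronFrobenius ↔ ∃ A : ℝ, ∀ a : ℝ, A ≤ a → EW a ∧ ¬ GSP a := by
  rw [polarPF_iff]
  push Not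
  rfl

/-- **Irrefutability short of #4's tail**: a refutation of crux #3 PROVES eventual even dominance. -/
theorem eventually_EW_of_not_polarPF (h : ¬ PolarPerronFrobenius) : ∀ᶠ a in atTop, EW a := by
  obtain ⟨A, hA⟩ := not_polarPF_iff.1 h
  exact eventually_atTop.2 ⟨A, fun a ha => (hA a ha).1⟩

/-- … and eventual ABSENCE of one-signed ground states. -/
theorem eventually_not_GSP_of_not_polarPF (h : ¬ PolarPerronFrobenius) : ∀ᶠ a in atTop, ¬ GSP a := by
  obtain ⟨A, hA⟩ := not_polarPF_iff.1 h
  exact eventually_atTop.2 ⟨A, fun a ha => (hA a ha).2⟩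

/-! ## Degenerate windows `a ≤ 0` -/

/-- No test function supported on a null window has `L²`-mass. -/
theorem integral_norm_sq_eq_zero_of_nonpos {a : ℝ} (ha : a ≤ 0) {o : ℝ → ℂ}
    (hsupp : tsupport o ⊆ Icc (-a) a) : ∫ t, ‖o t‖ ^ 2 = 0 := by
  have hvol : volume (Icc (-a) a) = 0 := by
    rw [Real.volume_Icc, ENNReal.ofReal_eq_zero]
    linarith
  have hae : (fun t : ℝ => ‖o t‖ ^ 2) =ᵐ[volume] fun _ => (0 : ℝ) := by
    filter_upwards [measure_eq_zero_iff_ae_notMem.1 hvol] with t ht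
    rw [image_eq_zero_of_notMem_tsupport fun h => ht (hsupp h), norm_zero, zero_pow two_ne_zero]
  rw [integral_congr_ae hae, integral_zero]

/-- `EW a` holds VACUOUSLY at a degenerate window (no normalised odd test exists). -/
theorem EW_of_nonpos {a : ℝ} (ha : a ≤ 0) : EW a := by
  intro o _ hsupp _ hnorm
  rw [integral_norm_sq_eq_zero_of_nonpos ha hsupp] at hnorm
  exact absurd hnorm (by norm_num)

/-- `GSP a` FAILS at a degenerate window (a minimising sequence would be normalised on a null set). -/
theorem not_GSP_of_nonpos {a : ℝ} (ha : a ≤ 0) : ¬ GSP a := by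
  rintro ⟨u, ⟨-, g, hg, -, -⟩, -⟩
  have h1 := (hg 0).2.2
  rw [integral_norm_sq_eq_zero_of_nonpos ha (hg 0).2.1] at h1
  exact absurd h1 (by norm_num)

/-- The matrix of the crux is FALSE at every degenerate window (harmless under `∃ a ≥ A`). -/
theorem not_imp_of_nonpos {a : ℝ} (ha : a ≤ 0) : ¬ (EW a → GSP a) :=
  fun h => not_GSP_of_nonpos ha (h (EW_of_nonpos ha))

/-- A window carrying a one-signed ground state is a genuine window. -/
theorem GSP.pos {a : ℝ} (h : GSP a) : 0 < a := by
  by_contra hle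
  exact not_GSP_of_nonpos (not_lt.1 hle) h

/-- The `∃ a ≥ A` of the crux always lands on a genuine window when its matrix is used non-vacuously. -/
theorem pos_of_imp_of_EW {a : ℝ} (h : EW a → GSP a) : 0 < a := by
  by_contra hle
  exact not_imp_of_nonpos (not_lt.1 hle) h

/-! ## Non-vacuity of the hypothesis `EW a` (certified range) -/

/-- `EW a` is INHABITED non-vacuously on every genuine window up to the second prime, `0 < a ≤ (log 3)/2`
(landed `evenSectorWins_upTo_logThreeHalf`, RH-free); beyond that it is the open residue `NoParityCrossing`. -/
theorem EW_of_le_logThreeHalf {a : ℝ} (ha : 0 < a) (hle : a ≤ Real.log 3 / 2) : EW a :=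
  Summit.RiemannHypothesis.RiemannHypothesis.Theorems.WeilParity.evenSectorWins_upTo_logThreeHalf a ha hle

/-! ## Relation to the rung, the detector and RH -/

/-- The route's support item is the PROVED OddSector statement, re-asked verbatim (definitional). -/
theorem oddNegativityOffLine_holds : OddNegativityOffLine :=
  Summit.RiemannHypothesis.RiemannHypothesis.Theorems.oddNegativityOffLine_proof

/-- The detector over the Literature vocabulary (definitional unfolding of the support item). -/
theorem oddNegativityOffLine_lit (hRH : ¬ RiemannHypothesis) :
    ∃ η : ℝ, 0 < η ∧ ∃ A : ℝ, ∀ a : ℝ, A ≤ a → ∃ h : ℝ → ℂ, IsWeilTest h ∧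
      tsupport h ⊆ Icc (-a) a ∧ (∀ t, h (-t) = -h t) ∧ ∫ t, ‖h t‖ ^ 2 = (1 : ℝ) ∧
      (weilQuadratic h).re ≤ -η :=
  oddNegativityOffLine_holds hRH

/-- **Off the line the rung forbids one-signed ground states at all large windows.** -/
theorem eventually_not_GSP_of_floor (hFloor : GroundBartaFloor) (hRH : ¬ RiemannHypothesis) :
    ∀ᶠ a in atTop, ¬ GSP a := by
  obtain ⟨η, hη, A, hAneg⟩ := oddNegativityOffLine_lit hRH
  obtain ⟨e, he, a₀, hfloor⟩ := groundBartaFloor_iff.1 hFloor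
  have hev : ∀ᶠ a in atTop, e a < η := he.eventually (Iio_mem_nhds hη)
  filter_upwards [hev, eventually_ge_atTop A, eventually_ge_atTop a₀] with a h1 h2 h3
  intro hG
  obtain ⟨h, hh, hsupp, -, hnorm, hneg⟩ := hAneg a h2
  have h4 := hfloor a h3 hG h hh hsupp hnorm
  linarith

/-- **Rung + cofinal one-signed ground states ⇒ RH** (the parity hypothesis `EW` is not needed for this). -/
theorem rh_of_floor_of_cofinal_GSP (hFloor : GroundBartaFloor) (h : ∀ A : ℝ, ∃ a : ℝ, A ≤ a ∧ GSP a) :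
    RiemannHypothesis := by
  by_contra hRH
  obtain ⟨A, hA⟩ := eventually_atTop.1 (eventually_not_GSP_of_floor hFloor hRH)
  obtain ⟨a, ha, hG⟩ := h A
  exact hA a ha hG

/-- **Given the rung, off the line crux #3 is EQUIVALENT to "crux #4 fails cofinally".** -/
theorem polarPF_iff_frequently_not_EW_of_floor (hFloor : GroundBartaFloor) (hRH : ¬ RiemannHypothesis) :
    PolarPerronFrobenius ↔ ∃ᶠ a in atTop, ¬ EW a := by
  constructor
  · intro hC
    refine not_eventually.1 fun hev => ?_
    obtain ⟨A, hA⟩ := eventually_atTop.1 (eventually_not_GSP_of_floor hFloor hRH)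
    obtain ⟨a, ha, hG⟩ := polarPF_iff_eventually_imp_cofinal.1 hC hev A
    exact hA a ha hG
  · exact polarPF_of_frequently_not_EW

/-- The route's `closes`, re-derived through the unfolded shape (sanity of the bookkeeping). -/
theorem rh_of_route (hFloor : GroundBartaFloor) (hPF : PolarPerronFrobenius) (hEven : EvenWinsBeyondArch) :
    RiemannHypothesis := by
  refine rh_of_floor_of_cofinal_GSP hFloor (polarPF_iff_eventually_imp_cofinal.1 hPF ?_)
  exact (eventually_gt_atTop (Real.log 2 / 2)).mono fun a ha => evenWinsBeyondArch_iff.1 hEven a ha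

end Summit.RiemannHypothesis.RiemannHypothesis.Cruxes.PolarPerronFrobenius.Attack
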